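import Literature.IUT.HodgeTheaters.DiscreteProfiniteConjugatesThm26Holds
import Literature.IUT.HodgeTheaters.SurfaceGroupLemma27
import Literature.IUT.HodgeTheaters.SurfaceGroupLemma27iv
import Literature.IUT.HodgeTheaters.CommensuratorLemmas
import Literature.IUT.HodgeTheaters.TemperedCoveringsProofs
import Literature.IUT.HodgeTheaters.TemperedCoveringsFreeModelLevelCommTerminal
import HarnessLib

/-!
# Nonabelian free / surface groups are commensurably terminal in their profinite completions;
# [IUTchI] Prop. 2.2 ("in particular") and Prop. 2.4 (iii) PROVED at the free-group consistency model

Mochizuki, *Inter-universal Teichmüller theory I: construction of Hodge theaters*, kurims manuscript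
(May 2020), §2: Proposition 2.2, p. 45 ("in particular, `Π^tp_𝔾` is commensurably terminal in `Π̂_𝔾`"),
Proposition 2.4 (iii), p. 50 ("`Δ^tp_X` (resp. `Π^tp_X`) is commensurably terminal in `Δ̂_X` (resp.
`Π̂_X`)"), and Corollary 2.8, p. 59 [cite: Mochizuki2012, Prop 2.2 p.45; Prop 2.4(iii) p.50; Cor 2.8 p.59]
(D-0012 claim key; nothing of the series is asserted here).

PROOF-ONLY file (abc-iut cell, seat abc-iut-w4-d055; director-abc 2026-08-26 (C3) «FACT-LIST proving»,
rows F-2590 / F-2601 of plan/FACT-LIST.md — the typed predicates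
`TemperedGraphGroupData.CommensuratorsOfDecompositionSubgroups` and `StableCurveTemperedData.Prop24iii` of
`TemperedCoverings.lean`).  Those rows are SCHEMAS (their universal closures are refuted at a finite abelian
datum in `FactListL5TemperedSchemas.lean`); this file supplies the complementary POSITIVE half:

* `IsFreeOrSurface.exists_noncomm_of_finiteIndex` — in a nonabelian free group of finite rank or
  orientable surface group, every finite-index subgroup is nonabelian (from Lemma 2.7 (iii), (iv), both
  kernel theorems of the tree: an abelian finite-index subgroup would be cyclic and would kill the
  rank-two abelianization witness of a noncommuting pair);
* `IsFreeOrSurface.commensurator_range_toCompletion_eq` — **a nonabelian free group of finite rank or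
  orientable surface group `P` is commensurably terminal in its profinite completion**:
  `C_{P̂}(η(P)) = η(P)`.  Proof: if `γ` commensurates `η(P)`, then `H := η⁻¹(γ⁻¹ η(P) γ)` has finite
  index in `P` — so it is infinite and nonabelian — and `γ · η(H) · γ⁻¹ ⊆ η(P)`; Corollary 2.8 (b)
  (`FreeOrSurface.subgroupsOfComplexHyperbolicPi1_holds`, unconditional in the tree) gives `γ ∈ η(P)`.
  Hence `η(P)` is also normally terminal (`isNormallyTerminal_range_toCompletion`);
* at abc-iut-L5-d4's consistency datum `StableCurveTemperedData.FreeModel.toy` (`Π^tp = Δ^tp = F₂`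
  discrete, `Π̂ = Δ̂ = F̂₂`, `G_k = 1`): `FreeModel.graph_tp_in_hat` (the "in particular" clause of
  Prop. 2.2 for the model's 𝔾-data), `FreeModel.graph_tpH_in_tp` (`Π^tp_ℍ = ⟨x₀⟩` is commensurably
  terminal in `F₂` — malnormality of a primitive cyclic subgroup), and **`FreeModel.toy_prop24iii :
  toy.Prop24iii`** (Prop. 2.4 (iii) AS TYPED holds at the model), via abc-iut-L5-t11's `prop24iii_of_delta`.

HONEST SCOPE: a consistency-model instance, not the genuine 𝔛-datum of p. 46 (no curve, no [SemiAnbd]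
input); the `Π̂_ℍ`-clauses `hatH` / `tpH_in_hat` of Prop. 2.2 at the model are not treated here.  No
definition; nothing here bears on [IUTchIII] Cor. 3.12; instantiated ≠ endorsed; typed ≠ proved.
-/

namespace Literature.IUT.HodgeTheaters

open scoped Pointwise
open Literature.AnabelianGeometry.AbsoluteAnabelian (IsCommensurablyTerminal IsNormallyTerminal)

universe u

/-! ### Finite-index subgroups of nonabelian free / surface groups are nonabelian -/

section General

variable {P : Type u} [Group P]

/-- A group as in Theorem 2.6 containing a noncommuting pair is infinite: the rank-two abelianization
witness of Lemma 2.7 (iii) has infinite order. [cite: Mochizuki2012, Lem 2.7(iii) p.57] -/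
theorem IsFreeOrSurface.infinite_of_noncomm (hP : IsFreeOrSurface P) {x y : P} (hxy : x * y ≠ y * x) :
    Infinite P := by
  obtain ⟨G₁, n, hx, hy, _, _, hind⟩ := FreeOrSurface.rankTwoInAbelianization_holds P hP x y hxy
  -- `i ↦ X^i` is injective into `G₁^{ab}`
  have hinj : Function.Injective fun i : ℤ => Abelianization.of (⟨x ^ n, hx⟩ : G₁) ^ i := by
    intro i j hij
    have hij' : Abelianization.of (⟨x ^ n, hx⟩ : G₁) ^ i = Abelianization.of (⟨x ^ n, hx⟩ : G₁) ^ j :=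
      hij
    have h1 : Abelianization.of (⟨x ^ n, hx⟩ : G₁) ^ (i - j) *
        Abelianization.of (⟨y ^ n, hy⟩ : G₁) ^ (0 : ℤ) = 1 := by
      rw [zpow_zero, mul_one, zpow_sub, hij', mul_inv_cancel]
    have := (hind _ _ h1).1
    omega
  haveI : Infinite (Abelianization G₁) := Infinite.of_injective _ hinj
  haveI : Infinite G₁ :=
    Infinite.of_surjective (Abelianization.of : G₁ → Abelianization G₁) fun q =>
      QuotientGroup.induction_on q fun g => ⟨g, rfl⟩
  exact Infinite.of_injective (Subtype.val : G₁ → P) Subtype.val_injective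

/-- **In a nonabelian free group of finite rank or orientable surface group, every subgroup of finite
index is nonabelian.**  From Lemma 2.7 (iii) and (iv): were `H` abelian, `H ∩ G₁` would be CYCLIC, say
generated by `z`; the powers `x^{nk}, y^{nk} ∈ H ∩ G₁` (`k` the index of the normal core) would both be
powers of `z`, producing a nontrivial relation between their images in `G₁^{ab}`.
[cite: Mochizuki2012, Lem 2.7(iii)(iv) p.57] -/
theorem IsFreeOrSurface.exists_noncomm_of_finiteIndex (hP : IsFreeOrSurface P) {x y : P}
    (hxy : x * y ≠ y * x) (H : Subgroup P) [hH : H.FiniteIndex] :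
    ∃ a ∈ H, ∃ b ∈ H, a * b ≠ b * a := by
  by_contra hab
  push Not at hab
  obtain ⟨G₁, n, hx, hy, hfi, hn, hind⟩ := FreeOrSurface.rankTwoInAbelianization_holds P hP x y hxy
  haveI := hfi
  -- the normal core `N` of `H ∩ G₁`: normal, of finite index `k ≥ 1`
  haveI hHG : (H ⊓ G₁).FiniteIndex := ⟨Subgroup.index_inf_ne_zero hH.index_ne_zero hfi.index_ne_zero⟩
  set N : Subgroup P := (H ⊓ G₁).normalCore with hNdef
  set k : ℕ := N.index with hkdef
  have hk : k ≠ 0 := Subgroup.FiniteIndex.index_ne_zero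
  have hxN : (x ^ n) ^ k ∈ H ⊓ G₁ := Subgroup.normalCore_le _ (Subgroup.pow_index_mem N (x ^ n))
  have hyN : (y ^ n) ^ k ∈ H ⊓ G₁ := Subgroup.normalCore_le _ (Subgroup.pow_index_mem N (y ^ n))
  -- `H ∩ G₁` is abelian, hence cyclic (Lemma 2.7 (iv))
  have hcyc : IsCyclic ↥(H ⊓ G₁) :=
    FreeOrSurface.abelianSubgroupCyclic_holds P hP (H ⊓ G₁) fun a ha b hb => hab a ha.1 b hb.1
  obtain ⟨z, hz⟩ := @IsCyclic.exists_generator _ _ hcyc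
  obtain ⟨a, ha⟩ := Subgroup.mem_zpowers_iff.mp (hz ⟨(x ^ n) ^ k, hxN⟩)
  obtain ⟨b, hb⟩ := Subgroup.mem_zpowers_iff.mp (hz ⟨(y ^ n) ^ k, hyN⟩)
  have ha' : ((z : P)) ^ a = (x ^ n) ^ k := congrArg Subtype.val ha
  have hb' : ((z : P)) ^ b = (y ^ n) ^ k := congrArg Subtype.val hb
  -- read everything in `G₁` and its abelianization
  have hzG : (z : P) ∈ G₁ := z.2.2
  set X := Abelianization.of (⟨x ^ n, hx⟩ : G₁) with hXdef
  set Y := Abelianization.of (⟨y ^ n, hy⟩ : G₁) with hYdef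
  set Z := Abelianization.of (⟨(z : P), hzG⟩ : G₁) with hZdef
  have hXk : X ^ (k : ℤ) = Z ^ a := by
    have h1 : (⟨x ^ n, hx⟩ : G₁) ^ (k : ℤ) = (⟨(z : P), hzG⟩ : G₁) ^ a := by
      apply Subtype.ext
      change (x ^ n) ^ (k : ℤ) = (z : P) ^ a
      rw [zpow_natCast]
      exact ha'.symm
    rw [hXdef, hZdef, ← map_zpow, h1, map_zpow]
  have hYk : Y ^ (k : ℤ) = Z ^ b := by
    have h1 : (⟨y ^ n, hy⟩ : G₁) ^ (k : ℤ) = (⟨(z : P), hzG⟩ : G₁) ^ b := by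
      apply Subtype.ext
      change (y ^ n) ^ (k : ℤ) = (z : P) ^ b
      rw [zpow_natCast]
      exact hb'.symm
    rw [hYdef, hZdef, ← map_zpow, h1, map_zpow]
  -- the relation `X^{kb} · Y^{-ka} = Z^{ab} · Z^{-ab} = 1`
  have hrel : X ^ ((k : ℤ) * b) * Y ^ (-((k : ℤ) * a)) = 1 := by
    rw [zpow_neg, zpow_mul, hXk, zpow_mul, hYk, ← zpow_mul, ← zpow_mul, mul_comm a b, mul_inv_cancel]
  obtain ⟨h1, h2⟩ := hind _ _ hrel
  have hk0 : (k : ℤ) ≠ 0 := by exact_mod_cast hk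
  have hb0 : b = 0 := (mul_eq_zero.mp h1).resolve_left hk0
  have ha0 : a = 0 := (mul_eq_zero.mp (neg_eq_zero.mp h2)).resolve_left hk0
  -- hence `x^{nk} = 1`, so `X^k = 1`: a nontrivial relation, contradiction
  have hx1 : (⟨x ^ n, hx⟩ : G₁) ^ (k : ℤ) = 1 := by
    apply Subtype.ext
    change (x ^ n) ^ (k : ℤ) = (1 : P)
    rw [zpow_natCast, ← ha', ha0, zpow_zero]
  have hX1 : X ^ (k : ℤ) * Y ^ (0 : ℤ) = 1 := by
    rw [zpow_zero, mul_one, hXdef, ← map_zpow, hx1, map_one]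
  exact hk0 (hind _ _ hX1).1

/-! ### Commensurable terminality of `P` in `P̂` -/

/-- A finite-index subgroup of an infinite group is infinite (as a set). [folklore] -/
private theorem infinite_coe_of_index_ne_zero [Infinite P] (H : Subgroup P) (hH : H.index ≠ 0) :
    (H : Set P).Infinite := by
  rw [← Set.infinite_coe_iff]
  by_contra hfin
  rw [not_infinite_iff_finite] at hfin
  have h1 := Subgroup.card_mul_index H
  rw [Nat.card_eq_zero_of_infinite (α := P)] at h1
  have h2 : Nat.card H ≠ 0 := Nat.card_pos.ne'
  exact h2 ((mul_eq_zero.mp h1).resolve_right hH)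

/-- **A nonabelian free group of finite rank or orientable surface group is commensurably terminal in its
profinite completion**: `C_{P̂}(η(P)) = η(P)` — the "in particular" of [IUTchI] Prop. 2.2 / the
`Π`-clause of Prop. 2.4 (iii) for the DISCRETE free (or surface) group in its completion, deduced from
Cor. 2.8 (b).  (False for `P` abelian, e.g. `C_{ℤ̂}(ℤ) = ℤ̂`.) [cite: Mochizuki2012, Prop 2.2 p.45; Cor 2.8 p.59] -/
theorem IsFreeOrSurface.commensurator_range_toCompletion_eq (hP : IsFreeOrSurface P)
    (hna : ∃ x y : P, x * y ≠ y * x) :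
    Subgroup.Commensurable.commensurator (toCompletion P).range = (toCompletion P).range := by
  obtain ⟨x, y, hxy⟩ := hna
  haveI : Infinite P := hP.infinite_of_noncomm hxy
  refine isCommensurablyTerminal_of_le fun γ hγ => ?_
  -- `γ⁻¹` commensurates `η(P)` too
  have hγ' : γ⁻¹ ∈ Subgroup.Commensurable.commensurator (toCompletion P).range := inv_mem hγ
  rw [Subgroup.Commensurable.commensurator_mem_iff] at hγ'
  -- `H := η⁻¹(γ⁻¹ η(P) γ)`, a finite-index subgroup of `P`
  set H : Subgroup P :=
    (ConjAct.toConjAct γ⁻¹ • (toCompletion P).range).comap (toCompletion P) with hHdef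
  have hHidx : H.index ≠ 0 := by
    rw [hHdef, Subgroup.index_comap]; exact hγ'.1
  haveI : H.FiniteIndex := ⟨hHidx⟩
  have hmem : ∀ h ∈ H, γ * toCompletion P h * γ⁻¹ ∈ (toCompletion P).range := by
    intro h hh
    rw [hHdef, Subgroup.mem_comap, Subgroup.mem_pointwise_smul_iff_inv_smul_mem, ← map_inv, inv_inv,
      ConjAct.smul_def, ConjAct.ofConjAct_toConjAct] at hh
    exact hh
  have hHinf : (H : Set P).Infinite := infinite_coe_of_index_ne_zero H hHidx
  have hHna : ∃ a ∈ H, ∃ b ∈ H, a * b ≠ b * a := hP.exists_noncomm_of_finiteIndex hxy H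
  exact (FreeOrSurface.subgroupsOfComplexHyperbolicPi1_holds P hP H hHinf γ hmem).2 hHna

/-- The same, as the tree's predicate `IsCommensurablyTerminal`. [cite: Mochizuki2012, Prop 2.2 p.45] -/
theorem IsFreeOrSurface.isCommensurablyTerminal_range_toCompletion (hP : IsFreeOrSurface P)
    (hna : ∃ x y : P, x * y ≠ y * x) : IsCommensurablyTerminal (toCompletion P).range :=
  ⟨hP.commensurator_range_toCompletion_eq hna⟩

/-- Hence **normal terminality** `N_{P̂}(η(P)) = η(P)` ([IUTchI] Rmk 2.2.2 for the discrete free/surface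
group in its completion; cf. [André] Lemma 3.2.1). [cite: Mochizuki2012, Rmk 2.2.2 p.46] -/
theorem IsFreeOrSurface.isNormallyTerminal_range_toCompletion (hP : IsFreeOrSurface P)
    (hna : ∃ x y : P, x * y ≠ y * x) : IsNormallyTerminal (toCompletion P).range :=
  (hP.isCommensurablyTerminal_range_toCompletion hna).isNormallyTerminal

end General

/-! ### At the free-group consistency model `F₂ ↪ F̂₂` -/

namespace StableCurveTemperedData

namespace FreeModel

/-- `F₂` (the model's type synonym) is free of finite rank, hence "a group as in Theorem 2.6" (p. 56: "a free
discrete group of finite rank or an orientable surface group"). [cite: Mochizuki2012, Thm 2.6 p.56] -/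
theorem isFreeOrSurface_F2 : IsFreeOrSurface F2 :=
  Or.inl ⟨2, ⟨(MulEquiv.refl (FreeGroup (Fin 2)) : F2 ≃* FreeGroup (Fin 2))⟩⟩

/-- The two free generators of `F₂` do not commute (seen in `𝔖₃` under `x₀ ↦ (0 1)`, `x₁ ↦ (1 2)`). [folklore] -/
private theorem exists_noncomm_F2 : ∃ x y : F2, x * y ≠ y * x := by
  refine ⟨(FreeGroup.of 0 : FreeGroup (Fin 2)), (FreeGroup.of 1 : FreeGroup (Fin 2)), fun h => ?_⟩
  have h' : (FreeGroup.of 0 * FreeGroup.of 1 : FreeGroup (Fin 2)) = FreeGroup.of 1 * FreeGroup.of 0 := h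
  let f : FreeGroup (Fin 2) →* Equiv.Perm (Fin 3) := FreeGroup.lift ![Equiv.swap 0 1, Equiv.swap 1 2]
  have hf := congrArg f h'
  rw [map_mul, map_mul, FreeGroup.lift_apply_of, FreeGroup.lift_apply_of] at hf
  exact absurd hf (by decide)

/-- **[IUTchI] Prop. 2.2, "in particular", AT THE MODEL** (FACT-LIST F-2590, clause `tp_in_hat`): the
model's `Π^tp_𝔾 = F₂` is commensurably terminal in `Π̂_𝔾 = F̂₂`. [cite: Mochizuki2012, Prop 2.2 p.45] -/
theorem graph_tp_in_hat : IsCommensurablyTerminal toy.graph.ι.range :=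
  isFreeOrSurface_F2.isCommensurablyTerminal_range_toCompletion exists_noncomm_F2

/-- **[IUTchI] Rmk 2.2.2 AT THE MODEL** (normal terminality of `Π^tp_𝔾 = F₂` in `Π̂_𝔾 = F̂₂`; the typed
`TemperedNormallyTerminal` is vacuous at the model, whose label is `Σ̂ = {3}`, so the content is recorded
directly). [cite: Mochizuki2012, Rmk 2.2.2 p.46] -/
theorem graph_normallyTerminal : IsNormallyTerminal toy.graph.ι.range :=
  graph_tp_in_hat.isNormallyTerminal

/-- **[IUTchI] Prop. 2.2, clause `tpH_in_tp`, AT THE MODEL** (FACT-LIST F-2590): `Π^tp_ℍ = ⟨x₀⟩` is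
commensurably terminal in `Π^tp_𝔾 = F₂` — an element commensurating `⟨x₀⟩` conjugates a nontrivial power
of the primitive element `x₀` into `⟨x₀⟩`, hence lies in `⟨x₀⟩` ([MKS] Cor. 4.1.6; abc-iut-w4-d063's
`FreeModel.mem_zpowers_of_mem_commensurator_zpowers_inf` at `J = ⊤`). [cite: Mochizuki2012, Prop 2.2 p.45] -/
theorem graph_tpH_in_tp : IsCommensurablyTerminal toy.graph.TpH := by
  have hT : toy.graph.TpH = Subgroup.zpowers x0 := by
    change Subgroup.closure {x0} = _
    rw [Subgroup.zpowers_eq_closure]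
  refine ⟨isCommensurablyTerminal_of_le fun g hg => ?_⟩
  rw [hT] at hg ⊢
  refine mem_zpowers_of_mem_commensurator_zpowers_inf ⊤ (by rw [Subgroup.index_top]; exact one_ne_zero) ?_
  rwa [inf_top_eq]

/-- `Δ^tp_X` of the model is everything (`G_k = 1`). [claim: Mochizuki2012, status: disputed] -/
private theorem mem_deltaTp' (g : F2) : g ∈ toy.DeltaTp := by
  change g ∈ (1 : F2 →* Gk).ker
  rw [MonoidHom.ker_one]; trivial

/-- `Δ̂_X` of the model is everything (`G_k = 1`). [claim: Mochizuki2012, status: disputed] -/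
private theorem mem_deltaHat' (g : Hat) : g ∈ toy.DeltaHat := by
  change g ∈ (1 : Hat →* Gk).ker
  rw [MonoidHom.ker_one]; trivial

/-- At the model, `Δ^tp_X ↪ Δ̂_X` has range `= Δ̂_X ∩ Π^tp_X` read in `Δ̂_X`, i.e. the preimage of
`η(F₂)` under `Δ̂_X ↪ Π̂_X`. [claim: Mochizuki2012, status: disputed] -/
private theorem range_ιΔ_eq_comap : toy.ιΔ.range = toy.ιX.range.comap toy.DeltaHat.subtype := by
  ext d
  constructor
  · rintro ⟨t, rfl⟩
    exact ⟨(t : F2), rfl⟩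
  · rintro ⟨s, hs⟩
    exact ⟨⟨s, mem_deltaTp' s⟩, Subtype.ext hs⟩

/-- **[IUTchI] Prop. 2.4 (iii) AS TYPED HOLDS AT THE MODEL** (FACT-LIST F-2601, instance form):
`Δ^tp_X = F₂` is commensurably terminal in `Δ̂_X = F̂₂`, and `Π^tp_X` in `Π̂_X` (abc-iut-L5-t11's
`prop24iii_of_delta`).  The universal closure of `Prop24iii` is false (`FactListL5TemperedSchemas`); the
genuine instance is the binder `h24iii` at the 𝔛-datum of p. 46. [cite: Mochizuki2012, Prop 2.4(iii) p.50] -/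
theorem toy_prop24iii : toy.Prop24iii := by
  refine toy.prop24iii_of_delta ⟨?_⟩
  rw [range_ιΔ_eq_comap]
  refine IsCommensurablyTerminal.comap_of_surjective toy.DeltaHat.subtype (fun g => ?_)
    graph_tp_in_hat.commensurator_eq
  exact ⟨⟨g, mem_deltaHat' g⟩, rfl⟩

end FreeModel

end StableCurveTemperedData

end Literature.IUT.HodgeTheaters
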